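import Summits.CriticalPhenomena.CardyFormulaZ2.Theorems.CardyIKTransportIKLinearTransportStubConditionalRSWFlips
import Summits.CriticalPhenomena.CardyFormulaZ2.Theorems.CardyIKTransportIKLinearTransportStubConditionalRSWCells
import Summits.CriticalPhenomena.CardyFormulaZ2.Theorems.CardyIKTransportIKLinearTransportStubConditionalRSWFiniteEnergy

/-!
# Stub `stub_ConditionalRSW` (crux stmt-CriticalPhenomena-5076, line `pinned-diagram-exchange`):
# finite energy of the column-mixed IK gauge, IV — glue, and the reduction of the stub to large scales

* `condRSWBound_fixedScale` — for every `n ≥ 1` there is `c_n > 0` with `CondRSWBound c_n S n a b E` for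
  EVERY column pattern `S`, box position and measurable far event (parts I–III instantiated: the
  explicit row/column/plaquette flips of `…Flips`, the single-cell flips of `…Cells`, the finite-energy
  bound of `…FiniteEnergy`).
* `stub_ConditionalRSW_of_largeScales` — the registered stub follows from conditional RSW with ONE
  constant at all scales `n ≥ N`, for any `N` (the scales below `N` are covered by finite energy). What
  remains of the stub is exactly this large-scale, uniform-in-`S` box-crossing bound for the non-FKG
  colour field (route item stmt-CriticalPhenomena-5911, conditional form).
-/

noncomputable section

namespace Summit.CriticalPhenomena.CardyFormulaZ2.Theorems.IKLinearTransport.PinnedDiagramExchange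

open scoped symmDiff ENNReal
open MeasureTheory Literature.Probability.Percolation Literature.Probability.LatticeModels

/-- CONDITIONAL RSW AT EVERY FIXED SCALE for the explicit gauge and every column pattern `S`
(finite energy; constant `(2 min(q,1-q)⁻⁴)^{-2n²}`, `q = 2√3 - 3`). [folklore] -/
theorem condRSWBound_fixedScale : ∀ n : ℕ, 1 ≤ n →
    ∃ c : ℝ, 0 < c ∧ ∀ (S : Set ℤ) (a b : ℤ) (E : Set Obs), MeasurableSet E → CondRSWBound c S n a b E :=
  fun n hn => condRSWBound_fixedScale_of_cellFlips
    (fun c => exists_cellFlip (R := fun T ω => ((ω.1 ∆ T, ω.2) : Ω))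
      (C := fun T ω => ((ω.1, ω.2.1 ∆ T, ω.2.2) : Ω))
      (F := fun g ω => ((ω.1, ω.2.1, ω.2.2.1 ∆ {g}, ω.2.2.2.1 ∆ {g}, ω.2.2.2.2) : Ω))
      rowFlip_spec colFlip_spec faceFlip_spec c)
    (ENNReal.pow_ne_top faceFlip_factor_ne_top) n hn

/-- `CondRSWBound` is monotone in the constant. [folklore] -/
theorem crsw_condRSWBound_mono {c c' : ℝ} (hcc : c' ≤ c) {S : Set ℤ} {n : ℕ} {a b : ℤ} {E : Set Obs}
    (h : CondRSWBound c S n a b E) : CondRSWBound c' S n a b E :=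
  ⟨fun hd => (mul_le_mul_of_nonneg_right hcc measureReal_nonneg).trans (h.1 hd),
    fun hd => (mul_le_mul_of_nonneg_right hcc measureReal_nonneg).trans (h.2 hd)⟩

/-- REDUCTION OF THE STUB TO LARGE SCALES. If conditional RSW holds with one constant `c₀` at all
scales `n ≥ N` (the RSW content, route item stmt-5911 in conditional form), then — the scales below `N`
being covered by finite energy (`condRSWBound_fixedScale`) — the registered stub `stub_ConditionalRSW`
holds. [folklore] -/
theorem stub_ConditionalRSW_of_largeScales (N : ℕ) {c₀ : ℝ} (hc₀ : 0 < c₀)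
    (hRSW : ∀ (S : Set ℤ) (n : ℕ), N ≤ n → 1 ≤ n → ∀ (a b : ℤ) (E : Set Obs), MeasurableSet E →
      CondRSWBound c₀ S n a b E) :
    ∃ c : ℝ, 0 < c ∧ ∀ (S : Set ℤ) (n : ℕ), 1 ≤ n → ∀ (a b : ℤ) (E : Set Obs), MeasurableSet E →
      CondRSWBound c S n a b E := by
  induction N generalizing c₀ with
  | zero => exact ⟨c₀, hc₀, fun S n hn a b E hE => hRSW S n (Nat.zero_le n) hn a b E hE⟩
  | succ N ih =>
    rcases Nat.eq_zero_or_pos N with rfl | hN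
    · exact ⟨c₀, hc₀, fun S n hn a b E hE => hRSW S n hn hn a b E hE⟩
    · obtain ⟨c₁, hc₁, h₁⟩ := condRSWBound_fixedScale N hN
      refine ih (lt_min hc₀ hc₁) fun S n hNn hn a b E hE => ?_
      rcases Nat.eq_or_lt_of_le hNn with rfl | hlt
      · exact crsw_condRSWBound_mono (min_le_right _ _) (h₁ S a b E hE)
      · exact crsw_condRSWBound_mono (min_le_left _ _) (hRSW S n hlt hn a b E hE)

end Summit.CriticalPhenomena.CardyFormulaZ2.Theorems.IKLinearTransport.PinnedDiagramExchange
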